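import Summits.Ventures.CertifiedArithmetic.LowPrec.GemmWorstCaseE2M1Prec
import Summits.Ventures.CertifiedArithmetic.LowPrec.GemmWorstCaseMonotone
import HarnessLib

/-!
# E2M1² → bfloat16: the first-regime closed form fails for EVERY `n ≥ 132` (kernel)

HONEST FRAMING (venture CertifiedArithmetic / cell `pub-lowprec`): certified error envelopes and
provably optimal rounding/accumulation schemes for low-precision formats under stated cost models;
every table by two implementations; no hardware or vendor claims.

`gemm.tex` Prop. p:sandwich / p:bf16law: the closed form `W(n) = max((n-2)/(286+n), (n-3)/(253+n))`
of the worst relative error of `n` products of two E2M1 values accumulated sequentially in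
`bfloat16` (RNE) is a KERNEL EQUALITY for `3 ≤ n ≤ 130` (`worstP_BFloat16_law`, file
`GemmFirstRegimeLawAllQ.lean`), a lower bound for every `n ≥ 3` (`max_low_le_worst`), and — this
file — is EXCEEDED for every `n ≥ 132`: the level-7 tie-chain family (a) of
`GemmTieChainFamilies.lean` (`16, 9, 24, 24, ¾^{×56}, ½, -½, -½, …`, ratio `(2n-61)/(2n+341)`,
`TieChain.bf16_l7a_ratio`) is an input over the alphabet, and `(2n-61)/(2n+341) > (n-3)/(253+n)`
exactly when `n > 131` (`TieChain.crossovers`).  So the exact range of validity of the closed form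
is decided in the kernel up to the single length `n = 131`, where the closed-form value `1/3` is a
kernel lower bound (`worstP_BFloat16_lawValue_le_131`) and equality is the certified table value
(`GEMM-BOUNDS.md` §4, two implementations) — `n = 131 = 2 + 129` lies one step beyond the
hypothesis `k ≤ 2^{p-1} = 128` of every first-regime theorem.

No new definitions; three short corollaries of landed theorems.  No numerics.
-/

namespace Summit.Ventures.CertifiedArithmetic.LowPrec.Gemm

open Literature.ComputerArithmetic.FloatingPoint
open Literature.ComputerArithmetic.FloatingPoint.MiniFloat
open Finset

/-- THE CLOSED FORM FAILS FROM `n = 132` ON: for every `n ≥ 132`,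
`max((n-2)/(286+n), (n-3)/(253+n)) < W(n)` (index `m = n - 1`), witnessed by the level-7 family (a).
[cell, gemm.tex Prop. p:sandwich (i)/(iii)] -/
theorem worstP_BFloat16_law_fails {n : ℕ} (hn : 132 ≤ n) :
    max (((n : ℚ) - 2) / (286 + n)) (((n : ℚ) - 3) / (253 + n))
      < worstRelErrE2M1 Format.BFloat16 (n - 1) := by
  have h := TieChain.bf16_l7a_ratio n (by omega)
  have w := relErr_le_worstP Format.BFloat16 TieChain.bf16_l7a TieChain.bf16_l7a_mem (n - 1)
  unfold relErr at w
  rw [show n - 1 + 1 = n by omega, h] at w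
  have hnq : (132 : ℚ) ≤ n := by exact_mod_cast hn
  refine lt_of_lt_of_le (max_lt ?_ ?_) w
  · rw [div_lt_div_iff₀ (by linarith) (by linarith)]; nlinarith
  · exact (TieChain.crossovers (n : ℚ) (by linarith)).1.2 (by linarith)

/-- In particular at `n = 132`: `W(132) > 129/385 = max(130/418, 129/385)` (the certified value is
`203/605`, the level-7 family (a)). [cell, gemm.tex Prop. p:sandwich (i)] -/
theorem worstP_BFloat16_law_fails_132 :
    (129 : ℚ) / 385 < worstRelErrE2M1 Format.BFloat16 131 ∧
      (203 : ℚ) / 605 ≤ worstRelErrE2M1 Format.BFloat16 131 := by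
  have w := relErr_le_worstP Format.BFloat16 TieChain.bf16_l7a TieChain.bf16_l7a_mem 131
  unfold relErr at w
  rw [show (131 : ℕ) + 1 = 132 from rfl, TieChain.bf16_l7a_ratio 132 (by norm_num)] at w
  norm_num at w
  exact ⟨lt_of_lt_of_le (by norm_num) w, w⟩

/-- AT `n = 131` the closed-form value `max(129/417, 128/384) = 1/3` is a (kernel) lower bound of
`W(131)`; equality `W(131) = 1/3` is the certified table value only. [cell, gemm.tex Prop. p:bf16law] -/
theorem worstP_BFloat16_lawValue_le_131 :
    max ((129 : ℚ) / (288 + 129)) (((129 : ℚ) - 1) / (255 + 129)) = 1 / 3 ∧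
      (1 : ℚ) / 3 ≤ worstRelErrE2M1 Format.BFloat16 130 := by
  have h := max_low_le_worst 130 (by norm_num)
  rw [← worstRelErrE2M1_BFloat16] at h
  refine ⟨by norm_num, le_trans ?_ (le_trans (le_max_right _ _) h)⟩
  norm_num

end Summit.Ventures.CertifiedArithmetic.LowPrec.Gemm
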